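import Literature.AlgebraicGeometry.Hu2025.Proofs.S05ThetaBlowups.SpanLe516
import Mathlib.RingTheory.GradedAlgebra.Homogeneous.Ideal
import Mathlib.Tactic.FinCases
/-!
# Hu 2025 §5.3 Prop. 5.12 (WEAK reading, row 106c `Prop5_12_weak`) — KERNEL DISCHARGE on the typed carrier: `Ṽ_{ϑ[k]} ∩ 𝔙` is
# `𝕋`-stable (its chart ideal is generated by weighted-homogeneous polynomials for the lifted weights)

M-HU PREP by res-type-023 (gen 9), 2026-08-27 — FILED by res-type-055 (gen 9) as PARTITION-HU §3b HELPER for the row-106 owner res-type-023 (author of record; res-plan-2 IDLE POOL DEAL #4b 2026-08-27T08:54:38Z; helper TAKING 08:56:19Z, no objection) from the owner's deposited copy of record HOME/plan/tools/res-type-023/hu/file/Prop512.lean sha16 1ab9d773e3110369, UNCHANGED except this filing note; S files R106cThetaBlowups = p518536 · R106dThetaEquations = p521266; Proofs chain Charts = p514775 · Prop511 = p519351 · Prop511L = p523180 · Cor518 = p524076 · Disp516Word = p524851 · Disp516 = p525463 · SpanLe516 = p526113 (target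
`Literature/AlgebraicGeometry/Hu2025/Proofs/S05ThetaBlowups/Prop512.lean`, kind proof, after Def54). Theorems about OUR carriers; nothing
of [Hu25] is asserted; «quasi-free» (the part of Prop. 5.12 the WEAK reading omits) is not addressed. AI work, weaker than expert review.

`Prop5_12_weak Φ R wt` (C38L56–L62, weak): if the starting relations `eqns0` of `𝒱 ∩ 𝔙_[0]` are weighted-homogeneous for a weight
`wt : Var_{𝔙_[0]} → M` (the character lattice of `𝕋`), then for every word `c` and level `k` the chart ideal `idealVTilde R c k` of
`Ṽ_{ϑ[k]} ∩ 𝔙` is generated by polynomials weighted-homogeneous for the lifted weights `wtAt wt c k`. PROVED (`Prop5_12_weak_holds`),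
for every frame and ring, via Mathlib's graded-ring API: each blow-up step `π^*` is a GRADED map `(R[V], wt) → (R[V], stepWt wt)`
(`ChartStep.isWeightedHomogeneous_pullback`: the substitution `x_j ↦ ζ·x_j` with the new weight `wt j − wt ζ` of `x_j`, C36L159–L174
/ C37L141–L150), homogeneous ideals are stable under graded extension, colon by a homogeneous element (`ζⁿ`) and `⨆`
(`ChartStep.isHomogeneous_strictTransform`), and `ThetaFrame.wtAt` is the fold of `stepWt` along the word (`wtAt_eq_foldl_seq`).
-/

noncomputable section

open MvPolynomial

namespace Literature.AlgebraicGeometry.Hu2025.Statements.S05ThetaBlowups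

universe u v

attribute [local instance] MvPolynomial.weightedGradedAlgebra

variable {R : Type u} [CommRing R] {V : Type v} [DecidableEq V] {M : Type*} [AddCommGroup M]

/-! ## One step is a graded map for the shifted weights -/

namespace ChartStep

variable (s : ChartStep V)

/-- The weights after one blow-up step: the non-exceptional centre variables `x_j ↦ ζ·x_j` get weight `wt j − wt ζ`, everything else
(including `ζ`, which keeps its name) keeps its weight (Prop. 5.10 proof C36L159–L174; C37L141–L150 / C38L11–L20).
[cite: Hu2025, Prop. 5.12 (with Prop. 5.10), pp. 85, 88 (unrefereed preprint arXiv:2507.21400v1 under adjudication, D-0012/D-0089 — kernel support on OUR typed carrier of row 106; nothing of the source asserted)] -/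
def stepWt (w : V → M) : V → M := fun j => if j ∈ s.centre ∧ j ≠ s.exc then w j - w s.exc else w j

/-- `ζ` keeps its weight (it keeps its name on the chart, C37L149 / C38L19). [cite: Hu2025, Prop. 5.12 (with Prop. 5.10), pp. 85, 88 (unrefereed preprint arXiv:2507.21400v1 under adjudication, D-0012/D-0089 — kernel support on OUR typed carrier of row 106; nothing of the source asserted)] -/
theorem stepWt_exc (w : V → M) : s.stepWt w s.exc = w s.exc := by simp [stepWt]

/-- The pulled-back exponent has the same weight for the shifted weights.
[cite: Hu2025, Prop. 5.12 (with Prop. 5.10), pp. 85, 88 (unrefereed preprint arXiv:2507.21400v1 under adjudication, D-0012/D-0089 — kernel support on OUR typed carrier of row 106; nothing of the source asserted)] -/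
theorem weight_pullbackExp (w : V → M) (T : V →₀ ℕ) :
    Finsupp.weight (s.stepWt w) (s.pullbackExp T) = Finsupp.weight w T := by
  induction T using Finsupp.induction with
  | zero => simp [pullbackExp_zero]
  | single_add i k T hi hk ih =>
    rw [pullbackExp_add, map_add, map_add, ih, pullbackExp_single, map_add, Finsupp.weight_single, Finsupp.weight_single,
      Finsupp.weight_single, stepWt_exc]
    congr 1
    by_cases h : i ∈ s.centre ∧ i ≠ s.exc
    · rw [if_pos h, show s.stepWt w i = w i - w s.exc by simp [stepWt, h], smul_sub, sub_add_cancel]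
    · rw [if_neg h, show s.stepWt w i = w i by simp [stepWt, h], zero_smul, add_zero]

/-- **`π^*_{𝔙,𝔙'}` is graded:** a `wt`-homogeneous polynomial of weight `d` pulls back to a `stepWt wt`-homogeneous polynomial of
weight `d`.
[cite: Hu2025, Prop. 5.12 (with Prop. 5.10), pp. 85, 88 (unrefereed preprint arXiv:2507.21400v1 under adjudication, D-0012/D-0089 — kernel support on OUR typed carrier of row 106; nothing of the source asserted)] -/
theorem isWeightedHomogeneous_pullback {w : V → M} {f : MvPolynomial V R} {d : M} (hf : IsWeightedHomogeneous w f d) :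
    IsWeightedHomogeneous (s.stepWt w) (s.pullback (R := R) f) d := by
  rw [f.as_sum, map_sum]
  refine IsWeightedHomogeneous.sum _ _ _ fun T hT => ?_
  rw [pullback_monomial]
  exact isWeightedHomogeneous_monomial _ _ _ (by rw [weight_pullbackExp]; exact hf (mem_support_iff.mp hT))

variable [DecidableEq M]

/-- Graded extension: the total transform of a homogeneous ideal is homogeneous (for the shifted weights).
[cite: Hu2025, Prop. 5.12 (with Prop. 5.10), pp. 85, 88 (unrefereed preprint arXiv:2507.21400v1 under adjudication, D-0012/D-0089 — kernel support on OUR typed carrier of row 106; nothing of the source asserted)] -/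
theorem isHomogeneous_map_pullback {w : V → M} {I : Ideal (MvPolynomial V R)}
    (hI : I.IsHomogeneous (weightedHomogeneousSubmodule R w)) :
    (I.map (s.pullback (R := R))).IsHomogeneous (weightedHomogeneousSubmodule R (s.stepWt w)) := by
  obtain ⟨S, hS⟩ := (Ideal.IsHomogeneous.iff_exists _ I).mp hI
  rw [hS, Ideal.map_span]
  refine Ideal.homogeneous_span _ _ ?_
  rintro _ ⟨_, ⟨y, hy, rfl⟩, rfl⟩
  obtain ⟨i, hi⟩ := y.2
  exact ⟨i, (mem_weightedHomogeneousSubmodule _ _ _ _).mpr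
    (s.isWeightedHomogeneous_pullback ((mem_weightedHomogeneousSubmodule _ _ _ _).mp hi))⟩

omit [DecidableEq V] in
/-- Colon by a homogeneous element preserves homogeneity.
[cite: Hu2025, Prop. 5.12 (with Prop. 5.10), pp. 85, 88 (unrefereed preprint arXiv:2507.21400v1 under adjudication, D-0012/D-0089 — kernel support on OUR typed carrier of row 106; nothing of the source asserted)] -/
theorem isHomogeneous_colon_of_mem {w : V → M} {J : Ideal (MvPolynomial V R)}
    (hJ : J.IsHomogeneous (weightedHomogeneousSubmodule R w)) {g : MvPolynomial V R} {e : M}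
    (hg : g ∈ weightedHomogeneousSubmodule R w e) :
    (J.colon ({g} : Set (MvPolynomial V R))).IsHomogeneous (weightedHomogeneousSubmodule R w) := by
  intro i r hr
  rw [Submodule.mem_colon_singleton, smul_eq_mul] at hr ⊢
  rw [← DirectSum.coe_decompose_mul_add_of_right_mem (weightedHomogeneousSubmodule R w) hg]
  exact (Ideal.IsHomogeneous.mem_iff _ hJ).mp hr (i + e)

/-- **The strict transform of a homogeneous ideal is homogeneous** (for the shifted weights): `⨆ₙ (π^* I : ζⁿ)`.
[cite: Hu2025, Prop. 5.12 (with Prop. 5.10), pp. 85, 88 (unrefereed preprint arXiv:2507.21400v1 under adjudication, D-0012/D-0089 — kernel support on OUR typed carrier of row 106; nothing of the source asserted)] -/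
theorem isHomogeneous_strictTransform {w : V → M} {I : Ideal (MvPolynomial V R)}
    (hI : I.IsHomogeneous (weightedHomogeneousSubmodule R w)) :
    (s.strictTransform (R := R) I).IsHomogeneous (weightedHomogeneousSubmodule R (s.stepWt w)) := by
  unfold strictTransform
  refine Ideal.IsHomogeneous.iSup fun n => ?_
  refine isHomogeneous_colon_of_mem (s.isHomogeneous_map_pullback hI)
    (e := Finsupp.weight (s.stepWt w) (Finsupp.single s.exc n)) ?_
  rw [mem_weightedHomogeneousSubmodule, excVar_eq, X_pow_eq_monomial]
  exact isWeightedHomogeneous_monomial _ _ _ rfl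

end ChartStep

/-! ## Along a word -/

namespace ChartSeq

/-- The weights after a word of steps.
[cite: Hu2025, Prop. 5.12 (with Prop. 5.10), pp. 85, 88 (unrefereed preprint arXiv:2507.21400v1 under adjudication, D-0012/D-0089 — kernel support on OUR typed carrier of row 106; nothing of the source asserted)] -/
def wordWt (L : ChartSeq V) (w : V → M) : V → M := L.foldl (fun w s => s.stepWt w) w

/-- Along a word: the strict transform of a homogeneous ideal is homogeneous for the weights after the word. [cite: Hu2025, Prop. 5.12 (with Prop. 5.10), pp. 85, 88 (unrefereed preprint arXiv:2507.21400v1 under adjudication, D-0012/D-0089 — kernel support on OUR typed carrier of row 106; nothing of the source asserted)] -/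
theorem isHomogeneous_strictTransform [DecidableEq M] (L : ChartSeq V) {w : V → M} {I : Ideal (MvPolynomial V R)}
    (hI : I.IsHomogeneous (weightedHomogeneousSubmodule R w)) :
    (ChartSeq.strictTransform R L I).IsHomogeneous (weightedHomogeneousSubmodule R (wordWt L w)) := by
  induction L generalizing w I with
  | nil => exact hI
  | cons s L ih => exact ih (s.isHomogeneous_strictTransform hI)

end ChartSeq

/-! ## The frame: `wtAt` is the fold of `stepWt` along the word -/

namespace ThetaFrame

variable {P : Type v} {Rs : Type v} [DecidableEq P] [DecidableEq Rs] (Φ : ThetaFrame P Rs)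

/-- The weight update of `wtAt` at block `j` is `stepWt` of the step at block `j`.
[cite: Hu2025, Prop. 5.12 (with Prop. 5.10), pp. 85, 88 (unrefereed preprint arXiv:2507.21400v1 under adjudication, D-0012/D-0089 — kernel support on OUR typed carrier of row 106; nothing of the source asserted)] -/
theorem wtAt_body_eq (c : Φ.Chart) (w : P ⊕ Rs → M) (j : Fin Φ.N) :
    ((Φ.lead j).elim w fun r => (c j).by
        (Function.update w (Sum.inr r) (w (Sum.inr r) - w (Sum.inl (Φ.ult j))))
        (Function.update w (Sum.inl (Φ.ult j)) (w (Sum.inl (Φ.ult j)) - w (Sum.inr r)))) =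
      (Φ.step c j).elim w fun s => s.stepWt w := by
  cases hl : Φ.lead j with
  | none => rw [Φ.step_of_lead_none hl]; rfl
  | some r =>
    obtain ⟨s, hstep, hexc⟩ := Φ.step_of_lead_some c hl
    have hcen := (Φ.step_spec hl hstep).1
    rw [hstep, Option.elim_some, Option.elim_some]
    funext v
    cases hk : c j with
    | varpi =>
      have he : s.exc = Sum.inl (Φ.ult j) := by rw [hexc, hk, ThetaKind.varpi_by]
      simp only [ThetaKind.varpi_by, ChartStep.stepWt, hcen, he, Finset.mem_insert, Finset.mem_singleton, Function.update_apply]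
      by_cases hv : v = Sum.inr r
      · subst hv; simp
      · rw [if_neg hv, if_neg]
        rintro ⟨(h | h), h'⟩
        · exact h' h
        · exact hv h
    | varrho =>
      have he : s.exc = Sum.inr r := by rw [hexc, hk, ThetaKind.varrho_by]
      simp only [ThetaKind.varrho_by, ChartStep.stepWt, hcen, he, Finset.mem_insert, Finset.mem_singleton, Function.update_apply]
      by_cases hv : v = Sum.inl (Φ.ult j)
      · subst hv; simp
      · rw [if_neg hv, if_neg]
        rintro ⟨(h | h), h'⟩
        · exact hv h
        · exact h' h

/-- **`wtAt` = the weights after the word of the chart.**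
[cite: Hu2025, Prop. 5.12 (with Prop. 5.10), pp. 85, 88 (unrefereed preprint arXiv:2507.21400v1 under adjudication, D-0012/D-0089 — kernel support on OUR typed carrier of row 106; nothing of the source asserted)] -/
theorem wtAt_eq_wordWt (wt : P ⊕ Rs → M) (c : Φ.Chart) (k : ℕ) :
    Φ.wtAt wt c k = ChartSeq.wordWt (Φ.seq c 0 k) wt := by
  simp only [wtAt, ChartSeq.wordWt, seq, List.foldl_filterMap]
  rw [List.filter_congr (fun (j : Fin Φ.N) _ => show decide (j.val < k) = decide (0 ≤ j.val ∧ j.val < k) by simp)]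
  congr 1
  funext w j
  rw [wtAt_body_eq]
  cases Φ.step c j <;> rfl

section WithRing

variable (R : Type u) [CommRing R]

/-- **Prop. 5.12 (weak reading) on the typed carrier:** `Ṽ_{ϑ[k]} ∩ 𝔙` is cut out by weighted-homogeneous polynomials for the lifted
weights, on every standard chart, whenever the starting list `eqns0` is weighted-homogeneous.
(The data binder `wt` is ∀-quantified in the statement — the same Π-type as the owner's `(wt : …) :` form; syntactic
normalisation at filing by the helper res-type-055 for the gate's D-0026 closed-discharge readout; proof unchanged but for `intro wt`.)
[cite: Hu2025, Prop. 5.12 (with Prop. 5.10), pp. 85, 88 (unrefereed preprint arXiv:2507.21400v1 under adjudication, D-0012/D-0089 — kernel support on OUR typed carrier of row 106; nothing of the source asserted)] -/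
theorem Prop5_12_weak_holds : ∀ wt : P ⊕ Rs → M, Prop5_12_weak Φ R wt := by
  classical
  intro wt hhom c k _
  have h0 : (Φ.idealV0 R).IsHomogeneous (weightedHomogeneousSubmodule R wt) :=
    Ideal.homogeneous_span _ _ fun f hf => by
      obtain ⟨d, hd⟩ := hhom f hf
      exact ⟨d, (mem_weightedHomogeneousSubmodule _ _ _ _).mpr hd⟩
  have hk : (Φ.idealVTilde R c k).IsHomogeneous (weightedHomogeneousSubmodule R (Φ.wtAt wt c k)) := by
    rw [wtAt_eq_wordWt]
    exact ChartSeq.isHomogeneous_strictTransform _ h0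
  obtain ⟨S, hS⟩ := (Ideal.IsHomogeneous.iff_exists _ _).mp hk
  refine ⟨Subtype.val '' S, hS.symm, ?_⟩
  rintro _ ⟨y, -, rfl⟩
  obtain ⟨d, hd⟩ := y.2
  exact ⟨d, (mem_weightedHomogeneousSubmodule _ _ _ _).mp hd⟩

end WithRing

end ThetaFrame

/-!
## Kernel witnesses for the READING `ThetaFrame.FormClauses` of Prop. 5.16 «Furthermore» (C39L25–L37) — non-vacuity

A toy frame with two blocks (`P = Rs = Fin 4`; block `0`: `u_0 = p₀`, leading ϱ-coordinate `r₀ = (m,u_0)` a variable; block `1`: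
`u_1 = p₁`, `(m,u_1) ∈ Λ^o`). On the all-ϖ word at level `1` (`𝔢_𝔙 = {u_0}`, `𝔡_𝔙 = ∅`): the term `T = x_{(m,u_0)}·x_{p₃}` of an
𝔯𝔟-type binomial pulls back to `T' = ε_{u_0}·x_{(m,u_0)}·x_{p₃}` — the printed form «ε_{𝔙,u} x_{𝔙,(m,u)} … if T contains
x_{(m,u)}» — and `FormClauses` HOLDS with `u_0` of rank 0 (`formClauses_toy_holds`); it FAILS if `u_0` is declared of positive rank
(`formClauses_toy_rank_fails`, the «hence u ∈ 𝕀^{lt,0}» clause has content) and FAILS for a term acquiring `ε_{u_0}` while containing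
neither `x_{(m,u_0)}` nor `x_{u_0}` (`formClauses_toy_form_fails`, the form clause has content). So the typed READING is neither
vacuous nor unsatisfiable. (Toy data OURS; nothing of [Hu25] asserted.)
-/

namespace ThetaFrame

/-- Toy frame for the `FormClauses` witnesses: two blocks over `P = Rs = Fin 4`; block `0` has the variable leading ϱ-coordinate
`r₀`, block `1` has its leading ϱ-coordinate `≡ 1`; two non-leading terms each.
[cite: Hu2025, Prop. 5.16 «Furthermore», p. 90 (unrefereed preprint arXiv:2507.21400v1 under adjudication, D-0012/D-0089 — OURS toy data for a kernel witness; nothing of the source asserted)] -/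
def toyForm : ThetaFrame (Fin 4) (Fin 4) where
  N := 2
  t := fun _ => 2
  ult := fun k => if k.val = 0 then 0 else 1
  lead := fun k => if k.val = 0 then some 0 else none
  termR := fun k τ => if k.val = 0 then (if τ.val = 0 then some 1 else none) else (if τ.val = 0 then some 2 else some 3)
  termP₁ := fun _ _ => 2
  termP₂ := fun _ _ => 3
  sgnLead := fun _ => 1
  sgnTerm := fun _ _ => 1
  blk := fun r => if r.val ≤ 1 then ⟨0, by decide⟩ else ⟨1, by decide⟩
  rb := ∅

/-- The all-ϖ word of the toy frame.
[cite: Hu2025, Def. 5.15, p. 89 (unrefereed preprint arXiv:2507.21400v1 under adjudication, D-0012/D-0089 — OURS toy data; nothing of the source asserted)] -/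
def toyFormB : toyForm.Chart := fun _ => ThetaKind.varpi

/-- **The standing facts `IsStandard` are SATISFIABLE** (non-vacuity of the `Φ.IsStandard →` guard of `Prop5_11`, `Prop5_11_labels`,
`Cor5_18`, `Cor5_18_cover`): the toy frame is standard — `u_k` distinct, `𝔱 = 2`, exactly one `≡ 1` coordinate per block, block
bookkeeping, unit signs.
[cite: Hu2025, Prop. 5.11 / Cor. 5.18 standing facts (C36L1–L2, C36L120, Def. 4.45), pp. 83–84 (unrefereed preprint arXiv:2507.21400v1 under adjudication, D-0012/D-0089 — kernel witness on OURS toy data; nothing of the source asserted)] -/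
theorem toyForm_isStandard : toyForm.IsStandard := by
  unfold IsStandard
  refine ⟨by decide, by decide, by decide, by decide, by decide, by decide, by decide, by decide⟩

/-- **`FormClauses` holds** on the toy ϖ-chart at level 1 for `T = x_{(m,u_0)} x_{p₃}`, `T' = ε_{u_0} x_{(m,u_0)} x_{p₃}`, with `u_0`
of rank 0 — the printed form «ε_{𝔙,u} x_{𝔙,(m,u)} for some u ∈ 𝔢_𝔙, if T contains x_{(m,u)}».
[cite: Hu2025, Prop. 5.16 «Furthermore», p. 90 (unrefereed preprint arXiv:2507.21400v1 under adjudication, D-0012/D-0089 — kernel witness for OUR reading; nothing of the source asserted)] -/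
theorem formClauses_toy_holds :
    toyForm.FormClauses (fun p => decide (p = 0)) toyFormB 1
      (Finsupp.single (Sum.inr 0) 1 + Finsupp.single (Sum.inl 3) 1)
      (Finsupp.single (Sum.inr 0) 1 + Finsupp.single (Sum.inl 3) 1 + Finsupp.single (Sum.inl 0) 1) := by
  have hE : toyForm.eSet toyFormB 1 = {0} := by decide
  have hD : toyForm.dSet toyFormB 1 = ∅ := by decide
  refine ⟨fun i hi _ => ?_, fun i r _ hr _ => absurd hr (by simp [hD])⟩
  rw [hE, Finset.mem_singleton] at hi
  have hi0 : i = ⟨0, by decide⟩ := by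
    fin_cases i
    · rfl
    · exact absurd hi (by decide)
  subst hi0
  refine ⟨by decide, Or.inl ⟨0, by decide, ?_, ?_⟩⟩ <;> simp

/-- **The rank clause has content:** the same data with `u_0` declared NOT of rank 0 violates `FormClauses`.
[cite: Hu2025, Prop. 5.16 «Furthermore» («hence u ∈ 𝕀^{lt,0}»), p. 90 (unrefereed preprint arXiv:2507.21400v1 under adjudication, D-0012/D-0089 — kernel witness for OUR reading; nothing of the source asserted)] -/
theorem formClauses_toy_rank_fails :
    ¬ toyForm.FormClauses (fun _ => false) toyFormB 1
      (Finsupp.single (Sum.inr 0) 1 + Finsupp.single (Sum.inl 3) 1)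
      (Finsupp.single (Sum.inr 0) 1 + Finsupp.single (Sum.inl 3) 1 + Finsupp.single (Sum.inl 0) 1) := by
  intro h
  have hE : toyForm.eSet toyFormB 1 = {0} := by decide
  have h0 := (h.1 ⟨0, by decide⟩ (by rw [hE]; decide) (by simp [toyForm])).1
  exact Bool.false_ne_true h0

/-- **The form clause has content:** a term `T = x_{p₃}` containing neither `x_{(m,u_0)}` nor `x_{u_0}` whose transform nevertheless
carried `ε_{u_0}` would violate `FormClauses` (even with `u_0` of rank 0).
[cite: Hu2025, Prop. 5.16 «Furthermore», p. 90 (unrefereed preprint arXiv:2507.21400v1 under adjudication, D-0012/D-0089 — kernel witness for OUR reading; nothing of the source asserted)] -/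
theorem formClauses_toy_form_fails :
    ¬ toyForm.FormClauses (fun p => decide (p = 0)) toyFormB 1
      (Finsupp.single (Sum.inl 3) 1)
      (Finsupp.single (Sum.inl 3) 1 + Finsupp.single (Sum.inl 0) 1) := by
  intro h
  have hE : toyForm.eSet toyFormB 1 = {0} := by decide
  obtain ⟨-, ⟨r, hr, hT, -⟩ | hT⟩ := h.1 ⟨0, by decide⟩ (by rw [hE]; decide) (by simp [toyForm])
  · simp at hT
  · simp [toyForm] at hT

/-- **Witness THROUGH the operator** (lane-B pre-read N2): for the 𝔯𝔟-type binomial `B = x_{(m,u_0)}·x_{p₃} − x_{p₂}` on the toy frame,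
the plus term of the Def. 5.13 transform `transformB` on the all-ϖ chart at level 1 IS `ε_{u_0}·x_{(m,u_0)}·x_{p₃}` (the step pulls
`x_{(m,u_0)} ↦ ε·x_{(m,u_0)}` back and `l_{φ,B} = 0`), and `FormClauses` holds for the pair (term of `B`, term of `transformB … B`).
[cite: Hu2025, Prop. 5.16 «Furthermore», p. 90 (unrefereed preprint arXiv:2507.21400v1 under adjudication, D-0012/D-0089 — kernel witness for OUR reading, through the typed operator; nothing of the source asserted)] -/
theorem formClauses_toy_transformB :
    let B : Binomial (Fin 4 ⊕ Fin 4) := ⟨Finsupp.single (Sum.inr 0) 1 + Finsupp.single (Sum.inl 3) 1, Finsupp.single (Sum.inl 2) 1⟩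
    (toyForm.transformB toyFormB 1 B).plus =
        Finsupp.single (Sum.inr 0) 1 + Finsupp.single (Sum.inl 3) 1 + Finsupp.single (Sum.inl 0) 1 ∧
      toyForm.FormClauses (fun p => decide (p = 0)) toyFormB 1 B.plus (toyForm.transformB toyFormB 1 B).plus := by
  intro B
  have hstep : toyForm.step toyFormB ⟨0, by decide⟩ =
      some ⟨{Sum.inl 0, Sum.inr 0}, Sum.inl 0, by decide⟩ := rfl
  have hseq : toyForm.seq toyFormB 0 1 = [⟨{Sum.inl 0, Sum.inr 0}, Sum.inl 0, by decide⟩] := by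
    have h := toyForm.seq_succ toyFormB ⟨0, by decide⟩
    simp only [Nat.zero_add, hstep, Option.toList_some] at h
    rw [h]
    simp [ThetaFrame.seq]
  have hplus : (toyForm.transformB toyFormB 1 B).plus =
      Finsupp.single (Sum.inr 0) 1 + Finsupp.single (Sum.inl 3) 1 + Finsupp.single (Sum.inl 0) 1 := by
    simp only [ThetaFrame.transformB, hseq, ChartSeq.properTransform, List.foldl_cons, List.foldl_nil, ChartStep.properTransform,
      ChartStep.pullbackExp, lPhi, phiDeg, B]
    ext v
    have he : ({Sum.inl 0, Sum.inr 0} : Finset (Fin 4 ⊕ Fin 4)).erase (Sum.inl 0) = {Sum.inr 0} := by decide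
    simp only [he, Finset.sum_singleton, Finset.sum_pair (show (Sum.inl 0 : Fin 4 ⊕ Fin 4) ≠ Sum.inr 0 from Sum.inl_ne_inr),
      Finsupp.coe_add, Finsupp.coe_tsub, Pi.add_apply, Pi.sub_apply, Finsupp.single_apply]
    rcases v with v | v <;> fin_cases v <;> simp
  refine ⟨hplus, ?_⟩
  rw [hplus]
  exact formClauses_toy_holds

end ThetaFrame

end Literature.AlgebraicGeometry.Hu2025.Statements.S05ThetaBlowups

end
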